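import Summits.CriticalPhenomena.PercolationContinuityZ3.Theorems.PercNearOneGluingNoHeavyLowerTailSahiLatinZeroBottomCoreGeneral
import Summits.CriticalPhenomena.PercolationContinuityZ3.Theorems.PercNearOneGluingNoHeavyLowerTailSahiLatinZeroBottomBridgeFamily

/-!
# `NoHeavyLowerTail` (crux stmt-CriticalPhenomena-4575), Sahi programme (prim-master-conj gen 50): **TOP-SLICE DOMINANCE WITH THE SHARP CONSTANT
# `3/2` ON THE WHOLE CONJUNCTIVE ZERO-BOTTOM FAMILY WITH ARBITRARY PRIVATE BLOCKS, EVERY DIMENSION** (the general-core upgrade of gen 49's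
# single-bridge theorem `three_kappa_top_le_two_kappa_lowerStep_of_isBridgePad`)

Support file (`--supports stmt-CriticalPhenomena-4575`; one inductive predicate + proofs, no `sorry`, standard axioms).  Memo
`run/shared/lean/prim/prim-l12/FROM-prim-master-conj-g50-GENERAL-CORE.md`.  Nothing here asserts the crux, Kahn's conjecture or (C¼) in general.

THE MATHEMATICS.  The family `IsConjPad κ P b Q c` is generated from the GENERAL CORE instances on `[3]^{U ⊕ V}` — `P = S × [3]^V`, `b = Pᶜ`,
`Q = [3]^U × T`, `c = Qᶜ` for ARBITRARY finite index types `U, V` and ARBITRARY sets `S ⊆ [3]^U`, `T ⊆ [3]^V` (`grid4_core` of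
`…ZeroBottomCoreGeneral`) — by repeatedly adding a coordinate that is FREE (all four sets become cylinders) or a PRIMED LITERAL of threshold `1`
or `2` on the `P`-side (`P, b ↦ ofSections ∅ ∅ ·` resp. `ofSections ∅ · ·`; `Q, c` cylinders) or on the `Q`-side.  In prim-ineq-gen-4's language these
are the zero-bottom data `P = ℓ_{I′} ∧ P_U`, `P′ = ℓ_{I′}` (`b = P′ ∖ P`), `Q = ℓ_{J′} ∧ Q_V`, `Q′ = ℓ_{J′}` with literal conjunctions `ℓ_{I′}, ℓ_{J′}`,
ARBITRARY private blocks `P_U ⊆ [3]^U`, `Q_V ⊆ [3]^V` on pairwise disjoint coordinate sets `I′, J′, U, V`, and any number of further free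
coordinates: the whole CONJUNCTIVE zero-bottom family of gen 49's memo (unprimed literal blocks of ANY size — the "≤ 20" table is gone) together
with its THEOREM B′ (arbitrary private block up-sets; indeed arbitrary private block sets).
**THEOREM (`three_kappa_top_le_two_kappa_lowerStep_of_isConjPad`).**  For every member and EVERY up-set `F ⊇ P ∪ Q`:
   `3 · κ(F, P ∪ b, Q ∪ c) ≤ 2 · κ(ofSections F F F, ofSections P P (P ∪ b), ofSections Q Q (Q ∪ c))`,
i.e. the Latin kernel of the lower-step clothing is at least `3/2` times the kernel of its top sections (`4c₁ ≥ 3c₃`, the lower-step form of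
(C¼); top-slice dominance `κ_{n+1} ≥ (3/2)κ_n(top)` with the constant attained at the single bridges).  Ingredients: `grid4_of_isConjPad`
(induction: `grid4_core`, pairing lemmas of `…ZeroBottomGrid`), `psi_nonneg_of_grid4`, `three_kappa_top_le_iff_psi_nonneg` (`…ZeroBottomPsi`),
and `κ(F,P,Q) = 0` from independence (`P ⊥ Q` is carried through the induction, `invariants_of_isConjPad`).
HONEST LABEL: a theorem on an infinite sub-family of the zero-bottom family (Z) (clause-type primes and general `P′ ⊇ P` are NOT covered);
(C¼), top-slice dominance in general, `PatternPos d` for `d ≥ 5`, Kahn's conjecture remain OPEN. [this work]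
-/

namespace Summit.CriticalPhenomena.PercolationContinuityZ3.Theorems.SahiLatin

open Finset

/-! ## §1  The family -/

/-- **The conjunctive zero-bottom family with arbitrary private blocks** (general cores on `[3]^{U ⊕ V}`, closed under free / primed-literal
coordinate lifts). [this work] -/
inductive IsConjPad : ∀ (κ : Type) [Fintype κ] [DecidableEq κ], Finset (Pt κ) → Finset (Pt κ) → Finset (Pt κ) → Finset (Pt κ) → Prop
  | core {U V : Type} [Fintype U] [DecidableEq U] [Fintype V] [DecidableEq V] (S : Finset (Pt U)) (T : Finset (Pt V)) :
      IsConjPad (U ⊕ V) (cylL S) (cylL Sᶜ) (cylR T) (cylR Tᶜ)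
  | free {κ : Type} [Fintype κ] [DecidableEq κ] {P b Q c : Finset (Pt κ)} :
      IsConjPad κ P b Q c → IsConjPad (Option κ) (ofSections P P P) (ofSections b b b) (ofSections Q Q Q) (ofSections c c c)
  | primeP2 {κ : Type} [Fintype κ] [DecidableEq κ] {P b Q c : Finset (Pt κ)} :
      IsConjPad κ P b Q c → IsConjPad (Option κ) (ofSections ∅ ∅ P) (ofSections ∅ ∅ b) (ofSections Q Q Q) (ofSections c c c)
  | primeP1 {κ : Type} [Fintype κ] [DecidableEq κ] {P b Q c : Finset (Pt κ)} :
      IsConjPad κ P b Q c → IsConjPad (Option κ) (ofSections ∅ P P) (ofSections ∅ b b) (ofSections Q Q Q) (ofSections c c c)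
  | primeQ2 {κ : Type} [Fintype κ] [DecidableEq κ] {P b Q c : Finset (Pt κ)} :
      IsConjPad κ P b Q c → IsConjPad (Option κ) (ofSections P P P) (ofSections b b b) (ofSections ∅ ∅ Q) (ofSections ∅ ∅ c)
  | primeQ1 {κ : Type} [Fintype κ] [DecidableEq κ] {P b Q c : Finset (Pt κ)} :
      IsConjPad κ P b Q c → IsConjPad (Option κ) (ofSections P P P) (ofSections b b b) (ofSections ∅ Q Q) (ofSections ∅ c c)

/-! ## §2  The grid invariant on the family -/

/-- **`Grid4` holds on the whole conjunctive family** (general core `grid4_core`, lifts by the pairing lemmas). [this work] -/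
theorem grid4_of_isConjPad {κ : Type} [Fintype κ] [DecidableEq κ] {P b Q c : Finset (Pt κ)} (h : IsConjPad κ P b Q c) :
    Grid4 P b Q c := by
  induction h with
  | core S T => exact grid4_core S T
  | free _ ih => exact grid4_free ih
  | primeP2 _ ih => exact grid4_primeP_two ih
  | primeP1 _ ih => exact grid4_primeP_one ih
  | primeQ2 _ ih => exact grid4_primeQ_two ih
  | primeQ1 _ ih => exact grid4_primeQ_one ih

/-! ## §3  The invariants of the core -/

section core
variable {U V : Type} [Fintype U] [DecidableEq U] [Fintype V] [DecidableEq V]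

omit [Fintype U] [Fintype V] in
/-- Updating a second-block coordinate does not change the first block. [this work] -/
theorem fstPt_update_inr (u : Pt (U ⊕ V)) (j : V) (v : Fin 3) : fstPt (Function.update u (Sum.inr j) v) = fstPt u := by
  funext a; simp [fstPt, Function.update_of_ne]

omit [Fintype U] [Fintype V] in
/-- Updating a first-block coordinate does not change the second block. [this work] -/
theorem sndPt_update_inl (u : Pt (U ⊕ V)) (i : U) (v : Fin 3) : sndPt (Function.update u (Sum.inl i) v) = sndPt u := by
  funext b; simp [sndPt, Function.update_of_ne]

/-- A second-block axis is inessential for a first-block cylinder. [this work] -/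
theorem axisInessential_cylL_inr (S : Finset (Pt U)) (j : V) : AxisInessential (cylL S : Finset (Pt (U ⊕ V))) (Sum.inr j) := by
  intro x v
  rw [mem_cylL, mem_cylL, fstPt_update_inr]

/-- A first-block axis is inessential for a second-block cylinder. [this work] -/
theorem axisInessential_cylR_inl (T : Finset (Pt V)) (i : U) : AxisInessential (cylR T : Finset (Pt (U ⊕ V))) (Sum.inl i) := by
  intro x v
  rw [mem_cylR, mem_cylR, sndPt_update_inl]

/-- **The two blocks are independent**: `cylL S ⊥ cylR T`. [this work] -/
theorem indep_cylL_cylR (S : Finset (Pt U)) (T : Finset (Pt V)) : Indep (cylL S : Finset (Pt (U ⊕ V))) (cylR T) := by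
  intro i
  cases i with
  | inl a => exact Or.inr (axisInessential_cylR_inl T a)
  | inr b => exact Or.inl (axisInessential_cylL_inr S b)

/-- The core invariants: `S × Ω` and `Sᶜ × Ω` are disjoint, likewise on the second block, and the blocks are independent. [this work] -/
theorem invariants_core (S : Finset (Pt U)) (T : Finset (Pt V)) :
    Disjoint (cylL S : Finset (Pt (U ⊕ V))) (cylL Sᶜ) ∧ Disjoint (cylR T : Finset (Pt (U ⊕ V))) (cylR Tᶜ)
      ∧ Indep (cylL S : Finset (Pt (U ⊕ V))) (cylR T) := by
  refine ⟨?_, ?_, indep_cylL_cylR S T⟩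
  · rw [cylL_compl]; exact disjoint_compl_right
  · rw [cylR_compl]; exact disjoint_compl_right

end core

/-! ## §4  The invariants along the family and the theorem -/

/-- The invariants carried along the family: `P ∩ b = ∅`, `Q ∩ c = ∅`, `P ⊥ Q`. [this work] -/
theorem invariants_of_isConjPad {κ : Type} [Fintype κ] [DecidableEq κ] {P b Q c : Finset (Pt κ)} (h : IsConjPad κ P b Q c) :
    Disjoint P b ∧ Disjoint Q c ∧ Indep P Q := by
  induction h with
  | core S T => exact invariants_core S T
  | free _ ih =>
    exact ⟨disjoint_ofSections ih.1 ih.1 ih.1, disjoint_ofSections ih.2.1 ih.2.1 ih.2.1, indep_lift_free ih.2.2⟩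
  | primeP2 _ ih =>
    exact ⟨disjoint_ofSections (disjoint_empty_left _) (disjoint_empty_left _) ih.1, disjoint_ofSections ih.2.1 ih.2.1 ih.2.1,
      indep_lift_lit ih.2.2 (fun k _ => axisInessential_empty k) (fun k _ => axisInessential_empty k)⟩
  | primeP1 _ ih =>
    exact ⟨disjoint_ofSections (disjoint_empty_left _) ih.1 ih.1, disjoint_ofSections ih.2.1 ih.2.1 ih.2.1,
      indep_lift_lit ih.2.2 (fun k _ => axisInessential_empty k) (fun k hk => hk)⟩
  | primeQ2 _ ih =>
    exact ⟨disjoint_ofSections ih.1 ih.1 ih.1, disjoint_ofSections (disjoint_empty_left _) (disjoint_empty_left _) ih.2.1,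
      (indep_lift_lit ih.2.2.symm (fun k _ => axisInessential_empty k) (fun k _ => axisInessential_empty k)).symm⟩
  | primeQ1 _ ih =>
    exact ⟨disjoint_ofSections ih.1 ih.1 ih.1, disjoint_ofSections (disjoint_empty_left _) ih.2.1 ih.2.1,
      (indep_lift_lit ih.2.2.symm (fun k _ => axisInessential_empty k) (fun k hk => hk)).symm⟩

/-- **TOP-SLICE DOMINANCE WITH THE SHARP CONSTANT `3/2` ON THE CONJUNCTIVE ZERO-BOTTOM FAMILY WITH ARBITRARY PRIVATE BLOCKS** (every
dimension): for every member `(P, b, Q, c)` of `IsConjPad` (with `P′ = P ∪ b`, `Q′ = Q ∪ c`) and every up-set `F ⊇ P ∪ Q`,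
`3 · κ(F, P′, Q′) ≤ 2 · κ(ofSections F F F, ofSections P P P′, ofSections Q Q Q′)`. [this work] -/
theorem three_kappa_top_le_two_kappa_lowerStep_of_isConjPad {κ : Type} [Fintype κ] [DecidableEq κ] {P b Q c : Finset (Pt κ)}
    (h : IsConjPad κ P b Q c) {F : Finset (Pt κ)} (hF : IsUpperSet (F : Set (Pt κ))) (hPQ : P ∪ Q ⊆ F) :
    3 * kappa F (P ∪ b) (Q ∪ c) ≤ 2 * kappa (ofSections F F F) (ofSections P P (P ∪ b)) (ofSections Q Q (Q ∪ c)) := by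
  obtain ⟨hPb, hQc, hI⟩ := invariants_of_isConjPad h
  have h0 : kappa F P Q = 0 := kappa_eq_zero_of_indep_of_union_subset hI hPQ
  have hb : (P ∪ b) \ P = b := by
    rw [union_sdiff_left, Finset.sdiff_eq_self_iff_disjoint]; exact hPb.symm
  have hc : (Q ∪ c) \ Q = c := by
    rw [union_sdiff_left, Finset.sdiff_eq_self_iff_disjoint]; exact hQc.symm
  have key := (three_kappa_top_le_iff_psi_nonneg (F := F) (subset_union_left (s₁ := P) (s₂ := b))
    (subset_union_left (s₁ := Q) (s₂ := c)) h0).2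
  rw [hb, hc] at key
  exact key (psi_nonneg_of_grid4 (grid4_of_isConjPad h) hF hPQ)

/-- The same theorem in ratio-free "`Ψ ≥ 0`" form: for every member and every up-set `F ⊇ P ∪ Q`, `0 ≤ Ψ(F; P, b, Q, c)`. [this work] -/
theorem psi_nonneg_of_isConjPad {κ : Type} [Fintype κ] [DecidableEq κ] {P b Q c : Finset (Pt κ)}
    (h : IsConjPad κ P b Q c) {F : Finset (Pt κ)} (hF : IsUpperSet (F : Set (Pt κ))) (hPQ : P ∪ Q ⊆ F) : 0 ≤ Psi F P b Q c :=
  psi_nonneg_of_grid4 (grid4_of_isConjPad h) hF hPQ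

end Summit.CriticalPhenomena.PercolationContinuityZ3.Theorems.SahiLatin
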